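import Literature.NumberTheory.GaloisRepresentations.GalLayerSystemLayers
import Literature.NumberTheory.GaloisRepresentations.IdeleClassGroupLimitInflation
import HarnessLib

/-!
# The three Galois layer systems of the idèle class formation: `E ↦ Eˣ`, `E ↦ J_E` (`J̄ = lim→ J_E` as a discrete
# `Γ_F`-module), `E ↦ C_E` (= g15's `C̄`), and their inflations (Tate, C–F VII §8 Prop. 8.1, §9.7, §11.1)

Topic `NumberTheory/GaloisRepresentations`; namespace `Literature.NumberTheory.GaloisRepresentations` (definitions
`unitsData`, `ideleData`, `classData`; auxiliary statements in `IdeleClassBar`).  Sequel to `GalLayerSystem.lean`,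
`GalLayerSystemLayers.lean` (door-c5 g16: `GalLayerData F`, `D.toSystem`, limits as objects of door-c4's `DiscreteRepCat ℤ Γ_F`,
layers `D.layerCohomologyIso`, inflations `D.inf`) and the cell's finite-layer files (`IdeleGaloisRep.lean`: `ideleRep`,
`IdeleClassGaloisRep.lean`: `galoisRep`, `IdeleInflation.lean`: `unitsInf`/`ideleInf`/`classInf`, g15's
`IdeleClassGroupLimit*.lean`: `transHom`, `classBar`, `classBarD`).  Definitions with bodies and theorems; NO named fact, no
`sorry`, no instance, no notation.  Route A of crux `AnticycControlAdditiveK` (item 19295): the object `J̄` (Milne I Lemma 4.13,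
`Ext¹(M^D, J̄) = P¹(K, M)`) and the identification of the inflations.

Mathematics.  For number fields `E ≤ E'` among the finite Galois layers of `F̄/F`: the inclusion `Eˣ ⊆ E'ˣ`, the base change
of idèles `J_E → J_{E'}` (`x ↦ x ⊗ 1`, tree `AdeleRing.ideleBaseChange`) and of idèle classes `C_E → C_{E'}` are injective,
transitive and `Γ_F`-equivariant (`AdeleRing.smul_ideleBaseChange_tower`, `classGalAct_classBaseChange_tower`), and satisfy
Galois descent: `(E'ˣ)^{Gal(F̄/E)} = Eˣ` (Galois theory: `F̄^{Gal(F̄/E)} = E`), `J_{E'}^{Gal(E'/E)} = J_E` (Tate VII §8 Prop. 8.1,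
tree `AdeleRing.mem_range_ideleBaseChange_of_forall_smul_eq`), `C_{E'}^{Gal(E'/E)} = C_E` (Neukirch III (2.7), g15
`exists_transHom_eq_of_forall_classGalAct_eq`).  Hence three `GalLayerData`: `unitsData F`, `ideleData F`
(`J̄ := (ideleData F).toSystem.limit`, Tate VII §9.7 `J_{K̄} = lim J_L`), `classData F` — whose system IS g15's:
`(classData F).toSystem.limit = classBar F` and `….toD = classBarD F` hold DEFINITIONALLY (`classData_limit`, `classData_toD`).
The generic inflations `D.inf` are the cell's `unitsInf` / `ideleInf` / `classInf`; in particular `classInf F E E n = 𝟙` along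
the tautological algebra (the point left open in g15's design note) and `IdeleClassBar.layerInf = classInf` at every
`E ≤ E'`.

## What is formalised (`F : Type` a number field, `Γ = absoluteGaloisGroup F`)

* §7 `GalLayer.coe_restrictHom_apply`, `IdeleClassBar.baseChangeHom_self`, **`IdeleClassBar.transHom_eq_baseChangeHom`**.
* §8 **`unitsData F`**, **`ideleData F`**, **`classData F`** (`GalLayerData`; `_base_apply`/`_obj` lemmas),
  `classData_limit : (classData F).toSystem.limit = classBar F`, `classData_toD : … .toD = classBarD F`.
* §9 **`unitsData_inf`** (`= unitsInf`), **`ideleData_inf`** (`= ideleInf`), **`classData_inf`** (`= classInf`),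
  **`IdeleClassBar.classInf_self`** (`classInf F E E n = 𝟙`), **`IdeleClassBar.layerInf_eq_classInf`**.

## References
* J. W. S. Cassels, A. Fröhlich (eds.), *Algebraic Number Theory* (1967), Ch. VII (J. Tate) §8 Prop. 8.1, §9.7, §11.1.
  [CasselsFrohlichANT1967]
* J. Neukirch, *Class Field Theory — The Bonn Lectures* (2013), Part III §2 (2.5)–(2.7). [Neukirch2013]
* D. Harari, *Galois Cohomology and Class Field Theory* (2020), §13.1. [Harari2020]
-/

noncomputable section

open CategoryTheory groupCohomology NumberField
open Field (absoluteGaloisGroup)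
open Literature.Algebra.Homology
open Literature.NumberTheory.Automorphic Literature.NumberTheory.Automorphic.IdeleClassGroup
open Literature.NumberTheory.NumberFields
open scoped Classical

namespace Literature.NumberTheory.GaloisRepresentations

open IdeleClassBar

variable {F : Type} [Field F] [NumberField F]

/-! ## §7. Auxiliary: `σ|_E` on elements; g15's transition map is the base change at every `E ≤ E'` -/

namespace IdeleClassBar

omit [NumberField F] in
/-- `(σ|_E)(v) = σ(v)` in `F̄`. [cite: CasselsFrohlichANT1967, Ch. VII §1.1] -/
theorem GalLayer.coe_restrictHom_apply (E : GalLayer F) (σ : AlgebraicClosure F ≃ₐ[F] AlgebraicClosure F) (v : E.1) :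
    ((E.restrictHom σ v : E.1) : AlgebraicClosure F) = σ (v : AlgebraicClosure F) :=
  haveI := E.isGalois
  AlgEquiv.restrictNormal_commutes σ E.1 v

/-- **The base change `C_E → C_E` along the tautological algebra is the identity** (injective and idempotent by
transitivity: `ι(ι x) = ι x`). [cite: Neukirch2013, Part III §2 (2.7)] -/
theorem baseChangeHom_self {E : GalLayer F} (h : E ≤ E) (x : layerClass F E) : baseChangeHom h x = x :=
  baseChangeHom_injective h (baseChangeHom_baseChangeHom h h x)

/-- **g15's transition map is the base change for all `E ≤ E'`** (including `E = E'`). [cite: Harari2020, §13.1] -/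
theorem transHom_eq_baseChangeHom {E E' : GalLayer F} (h : E ≤ E') : transHom E E' h = baseChangeHom h := by
  by_cases heq : E = E'
  · subst heq
    exact AddMonoidHom.ext fun x => (transHom_self E h x).trans (baseChangeHom_self h x).symm
  · exact transHom_of_ne h heq

end IdeleClassBar

/-! ## §8. The three systems -/

variable (F)

/-- **The system `E ↦ Eˣ`** (units of the layers with the Galois action `Representation.ofMulDistribMulAction`, base change =
inclusion; descent by Galois theory, `F̄^{Gal(F̄/E)} = E`).
[cite: CasselsFrohlichANT1967, Ch. VII §8 (the sequence `1 → L* → J_L → C_L → 1`)] -/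
def unitsData : GalLayerData F where
  V E := AddCommGrpCat.of (Additive (E.1)ˣ)
  ρ E := Representation.ofMulDistribMulAction (E.1 ≃ₐ[F] E.1) (E.1)ˣ
  base E E' h :=
    letI := GalLayer.algebraOfLE h
    MonoidHom.toAdditive (α := (E.1)ˣ) (β := (E'.1)ˣ) (Units.map (algebraMap E.1 E'.1 : E.1 →+* E'.1).toMonoidHom)
  base_base E E' E'' h h' x := Additive.toMul.injective (Units.ext (Subtype.ext rfl))
  base_injective E E' h := fun x y hxy =>
    Additive.toMul.injective (Units.ext (Subtype.ext
      (congrArg (fun u : Additive (E'.1)ˣ => (((Additive.toMul u : (E'.1)ˣ) : E'.1) : AlgebraicClosure F)) hxy)))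
  base_ρ E E' h σ x := by
    letI := GalLayer.algebraOfLE h
    refine Additive.toMul.injective (Units.ext (Subtype.ext ?_))
    exact (GalLayer.coe_restrictHom_apply E σ ((Additive.toMul x : (E.1)ˣ) : E.1)).trans
      (GalLayer.coe_restrictHom_apply E' σ (algebraMap E.1 E'.1 ((Additive.toMul x : (E.1)ˣ) : E.1))).symm
  descent E M h y hy := by
    have hfix : ∀ σ : AlgebraicClosure F ≃ₐ[F] AlgebraicClosure F, σ ∈ E.1.fixingSubgroup →
        σ (((Additive.toMul y : (M.1)ˣ) : M.1) : AlgebraicClosure F) =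
          (((Additive.toMul y : (M.1)ˣ) : M.1) : AlgebraicClosure F) := fun σ hσ => by
      have h1 := congrArg
        (fun a : Additive (M.1)ˣ => (((Additive.toMul a : (M.1)ˣ) : M.1) : AlgebraicClosure F)) (hy σ hσ)
      exact (GalLayer.coe_restrictHom_apply M σ _).symm.trans h1
    have hmem : (((Additive.toMul y : (M.1)ˣ) : M.1) : AlgebraicClosure F) ∈ E.1 := by
      rw [← InfiniteGalois.fixedField_fixingSubgroup E.1, IntermediateField.mem_fixedField_iff]
      exact fun σ hσ => hfix σ hσ
    have hne : (⟨_, hmem⟩ : E.1) ≠ 0 := fun h0 => by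
      have h0' : (((Additive.toMul y : (M.1)ˣ) : M.1) : AlgebraicClosure F) = 0 := congrArg Subtype.val h0
      exact (Additive.toMul y : (M.1)ˣ).ne_zero (Subtype.ext h0')
    exact ⟨Additive.ofMul (Units.mk0 _ hne), Additive.toMul.injective (Units.ext (Subtype.ext rfl))⟩

/-- The base change of `unitsData` is the inclusion `Eˣ ⊆ E'ˣ` (on `F̄`-values, the identity).
[cite: CasselsFrohlichANT1967, Ch. VII §8] -/
theorem coe_unitsData_base {E E' : GalLayer F} (h : E ≤ E') (x : Additive (E.1)ˣ) :
    (((Additive.toMul ((unitsData F).base h x) : (E'.1)ˣ) : E'.1) : AlgebraicClosure F) =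
      ((Additive.toMul x : (E.1)ˣ) : E.1) := rfl

/-- `(unitsData F).obj E` is Mathlib's `Rep.ofAlgebraAutOnUnits F E` (definitionally). [cite: CasselsFrohlichANT1967, Ch. VII §8] -/
theorem unitsData_obj (E : GalLayer F) : (unitsData F).obj E = Rep.ofAlgebraAutOnUnits F E.1 := rfl

/-- **The system `E ↦ J_E` of idèle groups** (`ideleRep`, base change `AdeleRing.ideleBaseChange`; transitivity
`ideleBaseChange_ideleBaseChange`, equivariance `smul_ideleBaseChange_tower`, descent `J_{M}^{Gal(M/E)} = J_E`).
[cite: CasselsFrohlichANT1967, Ch. VII §8 Prop. 8.1 and §9.7] -/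
def ideleData : GalLayerData F where
  V E := haveI := E.numberField; AddCommGrpCat.of (Additive (ideleGroup E.1))
  ρ E := haveI := E.numberField; Representation.ofMulDistribMulAction (E.1 ≃ₐ[F] E.1) (ideleGroup E.1)
  base E E' h :=
    haveI := E.numberField
    haveI := E'.numberField
    letI := GalLayer.algebraOfLE h
    MonoidHom.toAdditive (α := ideleGroup E.1) (β := ideleGroup E'.1) (AdeleRing.ideleBaseChange E.1 E'.1)
  base_base E E' E'' h h' x := by
    haveI := E.numberField
    haveI := E'.numberField
    haveI := E''.numberField
    letI := GalLayer.algebraOfLE h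
    letI := GalLayer.algebraOfLE h'
    letI := GalLayer.algebraOfLE (h.trans h')
    haveI := GalLayer.isScalarTower_of_le_of_le h h'
    exact congrArg Additive.ofMul
      (AdeleRing.ideleBaseChange_ideleBaseChange E.1 E'.1 E''.1 (Additive.toMul x : ideleGroup E.1))
  base_injective E E' h := fun x y hxy => by
    haveI := E.numberField
    haveI := E'.numberField
    letI := GalLayer.algebraOfLE h
    exact (Additive.toMul (α := ideleGroup E.1)).injective
      (AdeleRing.ideleBaseChange_injective E.1 E'.1 (congrArg (Additive.toMul (α := ideleGroup E'.1)) hxy))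
  base_ρ E E' h σ x := by
    haveI := E.numberField
    haveI := E'.numberField
    haveI := E.isGalois
    haveI := E'.isGalois
    letI := GalLayer.algebraOfLE h
    haveI := GalLayer.isScalarTower_of_le h
    refine congrArg Additive.ofMul ?_
    change AdeleRing.ideleBaseChange E.1 E'.1 (E.restrictHom σ • (Additive.toMul x : ideleGroup E.1)) =
      E'.restrictHom σ • AdeleRing.ideleBaseChange E.1 E'.1 (Additive.toMul x : ideleGroup E.1)
    rw [AdeleRing.smul_ideleBaseChange_tower (K := F), GalLayer.restrictHom_restrictHom h σ]
  descent E M h y hy := by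
    haveI := E.numberField
    haveI := M.numberField
    haveI := E.isGalois
    haveI := M.isGalois
    letI := GalLayer.algebraOfLE h
    haveI := GalLayer.isScalarTower_of_le h
    haveI : IsGalois E.1 M.1 := IsGalois.tower_top_of_isGalois F E.1 M.1
    have hy' : ∀ τ : M.1 ≃ₐ[E.1] M.1, τ • (Additive.toMul y : ideleGroup M.1) = Additive.toMul y := fun τ => by
      obtain ⟨σ, hσE, hσ⟩ := exists_restrictNormal_eq h τ
      have h1 := congrArg (Additive.toMul (α := ideleGroup M.1)) (hy σ hσE)
      change (haveI := M.isGalois; σ.restrictNormal M.1) • (Additive.toMul y : ideleGroup M.1) = Additive.toMul y at h1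
      rw [hσ] at h1
      rwa [ideleGroup.smul_eq_smul_of_forall_apply_eq (σ := τ.restrictScalars F) (σ' := τ) (fun _ => rfl)] at h1
    obtain ⟨x, hx⟩ := AdeleRing.mem_range_ideleBaseChange_of_forall_smul_eq E.1 M.1 hy'
    exact ⟨Additive.ofMul x, congrArg Additive.ofMul hx⟩

/-- The base change of `ideleData` is `AdeleRing.ideleBaseChange` (along the inclusion algebra).
[cite: CasselsFrohlichANT1967, Ch. VII §9.7] -/
theorem toMul_ideleData_base {E E' : GalLayer F} (h : E ≤ E') (x : (ideleData F).V E) :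
    (haveI := E'.numberField; (Additive.toMul ((ideleData F).base h x) : ideleGroup E'.1)) =
      (haveI := E.numberField; haveI := E'.numberField; letI := GalLayer.algebraOfLE h;
        AdeleRing.ideleBaseChange E.1 E'.1 (Additive.toMul x : ideleGroup E.1)) := rfl

/-- `(ideleData F).obj E` is the cell's `ideleRep F E` (definitionally). [cite: CasselsFrohlichANT1967, Ch. VII §8] -/
theorem ideleData_obj (E : GalLayer F) :
    (ideleData F).obj E = (haveI := E.numberField; IdeleClassGroup.ideleRep F E.1) := rfl

/-- **The system `E ↦ C_E` of idèle class groups**: g15's data (`galoisRep`, `transHom`, `transHom_transHom`,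
`transHom_injective`, `transHom_layerAct`, `exists_transHom_eq_of_forall_classGalAct_eq`).
[cite: Neukirch2013, Part III §2 (2.7)][cite: Harari2020, §13.1] -/
def classData : GalLayerData F where
  V E := haveI := E.numberField; AddCommGrpCat.of (Additive (IdeleClassGroup E.1))
  ρ E := haveI := E.numberField; (IdeleClassGroup.galoisRep F E.1).ρ
  base E E' h := transHom E E' h
  base_base _ _ _ h h' x := transHom_transHom h h' x
  base_injective E E' h := transHom_injective E E' h
  base_ρ E E' h σ x := transHom_layerAct h σ x
  descent E M h y hy := by
    haveI := M.numberField
    haveI := M.isGalois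
    letI := GalLayer.algebraOfLE h
    haveI := GalLayer.isScalarTower_of_le h
    refine exists_transHom_eq_of_forall_classGalAct_eq h y fun τ => ?_
    obtain ⟨σ, hσE, hσ⟩ := exists_restrictNormal_eq h τ
    have h2 : layerAct F M σ y = y := hy σ hσE
    rw [layerAct_apply, hσ, classGalAct_restrictScalars] at h2
    exact congrArg Additive.toMul h2

/-- `(classData F).obj E` is the cell's `galoisRep F E` (definitionally). [cite: Harari2020, §13.1] -/
theorem classData_obj (E : GalLayer F) :
    (classData F).obj E = (haveI := E.numberField; IdeleClassGroup.galoisRep F E.1) := rfl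

/-- The base change of `classData` is g15's `transHom` (`= baseChangeHom`, `transHom_eq_baseChangeHom`).
[cite: Harari2020, §13.1] -/
theorem classData_base_apply {E E' : GalLayer F} (h : E ≤ E') (x : layerClass F E) :
    (classData F).base h x = transHom E E' h x := rfl

/-- **The system `E ↦ C_E` IS g15's: `(classData F).toSystem.limit = classBar F`** (definitionally).
[cite: Harari2020, §13.1] -/
theorem classData_limit : (classData F).toSystem.limit = classBar F := rfl

/-- `(classData F).toSystem.of E = ofLayer F E`. [cite: Harari2020, §13.1] -/
theorem classData_of (E : GalLayer F) : (classData F).toSystem.of E = ofLayer F E := rfl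

/-- `(classData F).toSystem.rep = barRep F`. [cite: Harari2020, §13.1] -/
theorem classData_rep : (classData F).toSystem.rep = barRep F := rfl

/-- **`(classData F).toSystem.toD = classBarD F`** (the object of `C_Γ`; definitionally). [cite: Harari2020, §13.1] -/
theorem classData_toD : (classData F).toSystem.toD = classBarD F := rfl

/-! ## §9. The inflations of the three systems are the cell's `unitsInf`, `ideleInf`, `classInf` -/

variable {F}

omit [NumberField F] in
/-- `GalLayer.resHom h` is `AlgEquiv.restrictNormalHom E` along the inclusion algebra (definitionally).
[cite: CasselsFrohlichANT1967, Ch. VII §11.1] -/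
theorem GalLayer.resHom_eq {E E' : GalLayer F} (h : E ≤ E') :
    GalLayer.resHom h = (haveI := E.isGalois; letI := GalLayer.algebraOfLE h;
      haveI := GalLayer.isScalarTower_of_le h; AlgEquiv.restrictNormalHom E.1) := rfl

/-- **`(unitsData F).inf h n = unitsInf F E E' n`.** [cite: CasselsFrohlichANT1967, Ch. VII §11.1] -/
theorem unitsData_inf {E E' : GalLayer F} (h : E ≤ E') (n : ℕ) :
    (unitsData F).inf h n =
      (haveI := E.numberField; haveI := E'.numberField; haveI := E.isGalois; letI := GalLayer.algebraOfLE h;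
        haveI := GalLayer.isScalarTower_of_le h; IdeleCohomology.unitsInf F E.1 E'.1 n) := by
  haveI := E.numberField
  haveI := E'.numberField
  haveI := E.isGalois
  letI := GalLayer.algebraOfLE h
  haveI := GalLayer.isScalarTower_of_le h
  exact map_congr' (GalLayer.resHom_eq h) _ _ (fun _ => rfl) n

/-- **`(ideleData F).inf h n = ideleInf F E E' n`.** [cite: CasselsFrohlichANT1967, Ch. VII §11.1] -/
theorem ideleData_inf {E E' : GalLayer F} (h : E ≤ E') (n : ℕ) :
    (ideleData F).inf h n =
      (haveI := E.numberField; haveI := E'.numberField; haveI := E.isGalois; letI := GalLayer.algebraOfLE h;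
        haveI := GalLayer.isScalarTower_of_le h; IdeleCohomology.ideleInf F E.1 E'.1 n) := by
  haveI := E.numberField
  haveI := E'.numberField
  haveI := E.isGalois
  letI := GalLayer.algebraOfLE h
  haveI := GalLayer.isScalarTower_of_le h
  exact map_congr' (GalLayer.resHom_eq h) _ _ (fun _ => rfl) n

/-- **`(classData F).inf h n = classInf F E E' n`** for ALL `E ≤ E'` (`transHom = classBaseChange`).
[cite: CasselsFrohlichANT1967, Ch. VII §11.1] -/
theorem classData_inf {E E' : GalLayer F} (h : E ≤ E') (n : ℕ) :
    (classData F).inf h n =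
      (haveI := E.numberField; haveI := E'.numberField; haveI := E.isGalois; letI := GalLayer.algebraOfLE h;
        haveI := GalLayer.isScalarTower_of_le h; IdeleCohomology.classInf F E.1 E'.1 n) := by
  haveI := E.numberField
  haveI := E'.numberField
  haveI := E.isGalois
  letI := GalLayer.algebraOfLE h
  haveI := GalLayer.isScalarTower_of_le h
  refine map_congr' (GalLayer.resHom_eq h) _ _ (fun x => ?_) n
  change transHom E E' h x = baseChangeHom h x
  rw [transHom_eq_baseChangeHom]

namespace IdeleClassBar

/-- **`classInf F E E n = 𝟙`** along the tautological algebra `E → E` of a layer (`= (classData F).inf le_rfl n`, which is the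
identity by `GalLayerData.inf_self`) — the statement left open in g15's design note. [cite: CasselsFrohlichANT1967, Ch. VII §11.1] -/
theorem classInf_self (E : GalLayer F) (h : E ≤ E) (n : ℕ) :
    (haveI := E.numberField; haveI := E.isGalois; letI := GalLayer.algebraOfLE h; haveI := GalLayer.isScalarTower_of_le h;
      IdeleCohomology.classInf F E.1 E.1 n) = 𝟙 _ := by
  rw [← classData_inf h n, GalLayerData.inf_self]
  rfl

/-- **`layerInf E E' h n = classInf F E E' n` for all `E ≤ E'`** (the case split in `layerInf` is immaterial).
[cite: CasselsFrohlichANT1967, Ch. VII §11.1] -/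
theorem layerInf_eq_classInf {E E' : GalLayer F} (h : E ≤ E') (n : ℕ) :
    layerInf E E' h n =
      (haveI := E.numberField; haveI := E'.numberField; haveI := E.isGalois; letI := GalLayer.algebraOfLE h;
        haveI := GalLayer.isScalarTower_of_le h; IdeleCohomology.classInf F E.1 E'.1 n) := by
  by_cases heq : E = E'
  · subst heq
    rw [layerInf_self, classInf_self]
  · exact layerInf_of_ne h heq n

/-- `layerInf = (classData F).inf`. [cite: CasselsFrohlichANT1967, Ch. VII §11.1] -/
theorem layerInf_eq_classData_inf {E E' : GalLayer F} (h : E ≤ E') (n : ℕ) :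
    layerInf E E' h n = (classData F).inf h n := by
  rw [layerInf_eq_classInf, classData_inf]

end IdeleClassBar

end Literature.NumberTheory.GaloisRepresentations

end
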